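import Summits.ResolutionOfSingularities.ResolutionOfSingularities.Theorems.EquisingularLiftEquisingularLiftNatNDRoundModel
import Summits.ResolutionOfSingularities.ResolutionOfSingularities.Theorems.EquisingularLiftEquisingularLiftNatNDChartPlays
import Literature.AlgebraicGeometry.Resolution.BlowupsExistence
import HarnessLib

/-!
# PORT DRAFT v4 (= SPEC v11 §13.13′ + §13.14 + §13.15) — [OURS · L1 W4.5b · idea-1 g23 · ROUND 12/13 · NOT a statement of any manuscript]

`Theorems/EquisingularLiftEquisingularLiftNatNDRoundModelSplit.lean` (lead-2 g7 / stub-2 files it VERBATIM; desk RULINGS 2026-08-28T14:29:10Z (1)(iii), 14:52:12Z LN cascade):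
§13.14 (B4α) SUB-SPLIT `toricChartHom`, `ToricStage` (with (TS0) smooth cones), `GoodPlay`, `PlayFacts` (B4α0), `ModelInit` (B4α1i), `ModelStep` (B4α1s), `ModelEnd` (B4α2),
PROVED `strataTower_of_goodPlay`, `modelRound_of_toricStage`; §13.13′ the LN chain `NDInvCLN`, `ndInvCLN_end`, `RoundAtNDFrameLN`, `TransportRoundLN`,
`roundAtNDFrameLN_of_model`, `ndInvLN_round_of` (PROVED, over the tree's `NDInvC`/`NDInvPersists`/`RoundFacts`); §13.15 (B4β) SUB-SPLIT `frameBaseMap`, `Linked`, `FStage`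
(locally Noetherian F-stages), `TransportInit` (B4β0), `TransportStep` (B4β1), `TransportEnd` (B4β2, with the `∃ Φ, ToricStage … A …` guard), PROVED `linkedTower_of_goodPlay`,
`transportRoundLN_of_toricStage`.  Bricks close BY NAME, binder order `(n) (k) [Field k] [IsAlgClosed k] (g) (hg : LocalND g)`: `playFacts (n) : PlayFacts n`,
`modelInit/modelStep/modelEnd … : ModelInit/ModelStep/ModelEnd n k g`, `transportInit/transportStep/transportEnd (n) (k) [Field k] [IsAlgClosed k] : TransportInit/…/TransportEnd n k`.
Sorry-free; clause-by-clause readings live in the SPEC `Cruxes/EquisingularLiftNatThree/NewtonNondegenerateRungK5.lean` §13.13′–§13.15.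
-/

set_option linter.dupNamespace false

noncomputable section

open CategoryTheory CategoryTheory.Limits AlgebraicGeometry TopologicalSpace Topology
open MvPolynomial
open Literature.AlgebraicGeometry.Resolution
open AlgebraicGeometry.Scheme.IdealSheafData

namespace Summit.ResolutionOfSingularities.ResolutionOfSingularities.Cruxes.EquisingularLiftNat.Sections.ND

section RoundModel

variable (n : ℕ) (k : Type) [Field k]

/-- The toric chart map `U_B → 𝔸ⁿ_k` on rings: `t_l ↦ ∏_i y_i^{B i l}` (so that `chartPull B g = toricChartHom n k B g`, `chartPull_eq_aeval`). [OURS · model object] -/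
def toricChartHom (B : Fin n → Fin n → ℕ) : MvPolynomial (Fin n) k →+* MvPolynomial (Fin n) k :=
  (MvPolynomial.aeval fun l => ∏ i, (MvPolynomial.X i : MvPolynomial (Fin n) k) ^ B i l).toRingHom

/-- **`ToricStage n k g Φ F φ E T`** — THE TORIC STAGE INVARIANT (see §13.14 text). [OURS · L1 W4.5b · definition] -/
def ToricStage (g : MvPolynomial (Fin n) k) (Φ : Finset (Finset (Ray n))) (F : AlgebraicGeometry.Scheme.{0}) (φ : F ⟶ Aff n k)
    (E : Boundary n F) (T : Set F) : Prop :=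
  (∀ σ ∈ Φ, IsSmoothCone σ) ∧
  (∀ x : F, ∃ σ ∈ Φ, ∃ (B : Fin n → Fin n → ℕ) (c : Aff n k ⟶ F), AlgebraicGeometry.IsOpenImmersion c ∧ x ∈ Set.range c.base ∧
      σ = Finset.univ.image (fun i => rayOf (B i)) ∧ IsUnit (zMat B).det ∧
      c ≫ φ = AlgebraicGeometry.Spec.map (CommRingCat.ofHom (toricChartHom n k B)) ∧
      (∀ i, (E (rayOf (B i))).comap c = coordHyperplane n k i) ∧
      (∀ ρ, ρ ∉ σ → (E ρ).comap c = ⊤) ∧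
      c ⁻¹' T = PrimeSpectrum.zeroLocus {toricStrict B g}) ∧
  CategoryTheory.IsIso (φ ∣_ (⟨{affOrigin n k}ᶜ, (isClosed_affOrigin n k).isOpen_compl⟩ : (Aff n k).Opens)) ∧
  T ∩ φ ⁻¹' {affOrigin n k}ᶜ = φ ⁻¹' (PrimeSpectrum.zeroLocus {g} \ {affOrigin n k}) ∧
  IsClosed T ∧
  (∀ ρ, ρ ∉ Set.range (e n) → ((E ρ).support : Set F) ⊆ φ ⁻¹' {affOrigin n k})

/-- **HEAD-STYLE GOOD PLAYS** `GoodPlay n V Φ Φ'`: `Φ'` is reached from `Φ` by finitely many stars, each at a `Bad` face `τ ⊆ σ ∈ Φ` containing a NON-FRAME ray and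
FRESH for the cones not containing it.  [OURS · L1 W4.5b · definition] -/
inductive GoodPlay (V : Finset (Fin n → ℕ)) : Finset (Finset (Ray n)) → Finset (Finset (Ray n)) → Prop
  | done (Φ : Finset (Finset (Ray n))) : GoodPlay V Φ Φ
  | move (Φ Φ' : Finset (Finset (Ray n))) (σ τ : Finset (Ray n)) :
      σ ∈ Φ → τ ⊆ σ → Bad V τ → (∃ ρ ∈ τ, ρ ∉ Set.range (e n)) →
      (∀ σ' ∈ Φ, ¬ τ ⊆ σ' → (∑ ρ ∈ τ, ρ) ∉ σ') →
      GoodPlay V (star Φ τ) Φ' → GoodPlay V Φ Φ'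

/-- **(B4α0) `PlayFacts n`** — the combinatorial driver: every won E1-legal play from the orthant on a convenient nonempty table yields a good head-style play from
the point-star position to a won position.  [OURS · L1 W4.5b · statement (Prop)] -/
def PlayFacts : Prop :=
  ∀ V : Finset (Fin n → ℕ), IsConvenientTable V → V.Nonempty →
    ∀ Φ' : Finset (Finset (Ray n)), Reach V (orthantFan n) Φ' → Won V Φ' →
      ∃ Φ'' : Finset (Finset (Ray n)), GoodPlay n V (star (orthantFan n) (Finset.univ.image (e n))) Φ'' ∧ Won V Φ''

/-- **(B4α1i) `ModelInit n k g`** — ANY blow-up of the origin of `𝔸ⁿ_k` is a toric stage at the point-star fan, with the stepped coordinate frame boundary and the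
strict transform of `V(g)`.  [OURS · L1 W4.5b · statement (Prop)] -/
def ModelInit (g : MvPolynomial (Fin n) k) : Prop :=
  ∀ (A₂ : AlgebraicGeometry.Scheme.{0}) (π₀ : A₂ ⟶ Aff n k),
    Literature.AlgebraicGeometry.Resolution.IsBlowup π₀
      (AlgebraicGeometry.Scheme.IdealSheafData.vanishingIdeal (⟨{affOrigin n k}, isClosed_affOrigin n k⟩ : TopologicalSpace.Closeds (Aff n k))) →
    ToricStage n k g (star (orthantFan n) (Finset.univ.image (e n))) A₂ π₀
      ((frameBoundary (coordHyperplane n k)).stepAlong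
        (AlgebraicGeometry.Scheme.IdealSheafData.vanishingIdeal (⟨{affOrigin n k}, isClosed_affOrigin n k⟩ : TopologicalSpace.Closeds (Aff n k))) 1 π₀)
      (closure (π₀ ⁻¹' (PrimeSpectrum.zeroLocus {g} \ {affOrigin n k})))

/-- **(B4α1s) `ModelStep n k g`** — ONE TORIC STAR: at a toric stage, a `Bad` face with a non-frame ray, fresh for the cones not containing it, is an E1-LEGAL centre
(`hE1`, `hT`), and ANY blow-up of its stratum is again a toric stage, at the starred fan, with the stepped boundary and the strict transform.  [OURS · L1 W4.5b] -/
def ModelStep (g : MvPolynomial (Fin n) k) : Prop :=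
  ∀ (Φ : Finset (Finset (Ray n))) (F : AlgebraicGeometry.Scheme.{0}) (φ : F ⟶ Aff n k) (E : Boundary n F) (T : Set F),
    ToricStage n k g Φ F φ E T →
    ∀ σ ∈ Φ, ∀ τ : Finset (Ray n), τ ⊆ σ → Bad (table g) τ → (∃ ρ ∈ τ, ρ ∉ Set.range (e n)) →
      (∀ σ' ∈ Φ, ¬ τ ⊆ σ' → (∑ ρ ∈ τ, ρ) ∉ σ') →
      (((stratum E τ).support : Set F) ⊆ T ∧ ¬ T ⊆ ((stratum E τ).support : Set F)) ∧
      ∀ (F' : AlgebraicGeometry.Scheme.{0}) (υ : F' ⟶ F), Literature.AlgebraicGeometry.Resolution.IsBlowup υ (stratum E τ) →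
        ToricStage n k g (star Φ τ) F' (υ ≫ φ) (E.stepAlong (stratum E τ) (∑ ρ ∈ τ, ρ) υ)
          (closure (υ ⁻¹' (T \ ((stratum E τ).support : Set F))))

/-- **(B4α2) `ModelEnd n k g`** — at a WON fan a toric stage is regular and its `T̂` is regular at every point over the origin (the END clause of `ModelRound`,
verbatim with `φ` for `β ≫ π₀`).  [OURS · L1 W4.5b · statement (Prop)] -/
def ModelEnd (g : MvPolynomial (Fin n) k) : Prop :=
  ∀ (Φ : Finset (Finset (Ray n))) (F : AlgebraicGeometry.Scheme.{0}) (φ : F ⟶ Aff n k) (E : Boundary n F) (T : Set F),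
    ToricStage n k g Φ F φ E T → Won (table g) Φ →
      Literature.AlgebraicGeometry.Resolution.Scheme.IsRegular F ∧
      (∀ z : ↥(AlgebraicGeometry.Scheme.IdealSheafData.vanishingIdeal (⟨closure T, isClosed_closure⟩ : TopologicalSpace.Closeds F)).subscheme, ((AlgebraicGeometry.Scheme.IdealSheafData.vanishingIdeal (⟨closure T, isClosed_closure⟩ : TopologicalSpace.Closeds F)).subschemeι z : F) ∈ φ ⁻¹' {affOrigin n k} →
        IsRegularLocalRing ((AlgebraicGeometry.Scheme.IdealSheafData.vanishingIdeal (⟨closure T, isClosed_closure⟩ : TopologicalSpace.Closeds F)).subscheme.presheaf.stalk z))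

/-- THE ITERATION (proved): along a good play, a toric stage grows a `StrataTower` ending in a toric stage at the final fan — each star realised by
`exists_isBlowup`, its legality and the new stage supplied by (B4α1s).  [OURS · pure logic + Literature `exists_isBlowup`] -/
theorem strataTower_of_goodPlay (g : MvPolynomial (Fin n) k) (hS : ModelStep n k g) {Φ Φ'' : Finset (Finset (Ray n))}
    (hP : GoodPlay n (table g) Φ Φ'') :
    ∀ (F : AlgebraicGeometry.Scheme.{0}) (φ : F ⟶ Aff n k) (E : Boundary n F) (T : Set F), ToricStage n k g Φ F φ E T →
      ∃ (F₉ : AlgebraicGeometry.Scheme.{0}) (β : F₉ ⟶ F) (T₉ : Set F₉) (E₉ : Boundary n F₉),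
        StrataTower F E T F₉ β T₉ ∧ ToricStage n k g Φ'' F₉ (β ≫ φ) E₉ T₉ := by
  induction hP with
  | done Φ =>
    intro F φ E T hst
    exact ⟨F, 𝟙 F, T, E, StrataTower.nil F E T, by rw [CategoryTheory.Category.id_comp]; exact hst⟩
  | move Φ Φ' σ τ hσ hτσ hbad hnf hfresh hrest ih =>
    intro F φ E T hst
    obtain ⟨⟨hE1, hT⟩, hstep⟩ := hS Φ F φ E T hst σ hσ τ hτσ hbad hnf hfresh
    obtain ⟨F', υ, hυ⟩ := Literature.AlgebraicGeometry.Resolution.exists_isBlowup F (stratum E τ)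
    obtain ⟨F₉, β, T₉, E₉, htower, hst₉⟩ := ih F' (υ ≫ φ) _ _ (hstep F' υ hυ)
    exact ⟨F₉, β ≫ υ, T₉, E₉, StrataTower.cons F E T τ hnf hE1 hT F' υ hυ F₉ β T₉ htower, by rw [CategoryTheory.Category.assoc]; exact hst₉⟩

/-- **THE (B4α) COMPOSITION, PROVED**: driver + init + step + end ⟹ `ModelRound` for every `g ∈ LocalNDWon`. [OURS · pure logic] -/
theorem modelRound_of_toricStage (h0 : PlayFacts n) (hI : ∀ g : MvPolynomial (Fin n) k, LocalND g → ModelInit n k g)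
    (hS : ∀ g : MvPolynomial (Fin n) k, LocalND g → ModelStep n k g) (hE : ∀ g : MvPolynomial (Fin n) k, LocalND g → ModelEnd n k g)
    (g : MvPolynomial (Fin n) k) (hg : LocalNDWon g) : ModelRound n k g := by
  obtain ⟨hL, Φ', hR, hW⟩ := hg
  have hV : (table g).Nonempty := table_nonempty (ne_zero_of_isLocallyND hL.2)
  obtain ⟨Φ'', hP, hW''⟩ := h0 (table g) (isConvenientTable_table hL.1) hV Φ' hR hW
  intro A₂ π₀ hπ₀
  obtain ⟨F₉, β, T₉, E₉, htower, hst₉⟩ := strataTower_of_goodPlay n k g (hS g hL) hP A₂ π₀ _ _ (hI g hL A₂ π₀ hπ₀)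
  obtain ⟨hreg, hend⟩ := hE g hL Φ'' F₉ (β ≫ π₀) E₉ T₉ hst₉ hW''
  obtain ⟨-, -, hiso, hbook, hclosed, -⟩ := hst₉
  exact ⟨F₉, β, T₉, htower, hreg, hclosed, hend, hiso, hbook⟩

/-! ## 13.13′ THE LOCALLY-NOETHERIAN (LN) CHAIN (v11; desk RULING 2026-08-28T14:52:12Z on stub-2's clause objection) — NEW NAMES over the tree's
`NDInv`/`NDInvC`/`RoundAtNDFrame`/`TransportRound`/`NDInvPersists` (p639684/p641231/p640760), nothing landed touched or shadowed: the k-side invariant now carries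
`IsLocallyNoetherian F` (every F-stage of the engine is of finite type over `k`; `Scheme.IsRegular` = regular STALKS does not give it, and the F-side T-clauses —
«closure of a flat preimage = preimage of the closure», `support_strictTransformIdeal_eq_closure` — have no proof without it).  (B4γ) `ndInv_init` is UNCHANGED
(`IsLocallyNoetherian ℙⁿ_k` at the call site by `LocallyOfFiniteType.isLocallyNoetherian`); the MODEL side (§13.14) is UNCHANGED. -/

/-- `NDInvCLN m F ρ T := NDInvC n k m F ρ T ∧ IsLocallyNoetherian F` — the closed ND invariant WITH local Noetherianity of the floor. [OURS · L1 W4.5b · definition] -/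
def NDInvCLN (m : ℕ) (F : AlgebraicGeometry.Scheme.{0}) (ρ : F ⟶ (Literature.AlgebraicGeometry.Motives.projectiveSpace n k).left) (T : Set F) : Prop :=
  NDInvC n k m F ρ T ∧ IsLocallyNoetherian F

/-- (B4-end) for `NDInvCLN`: at measure `0` the reduced closure is regular (from the tree's `ndInvC_end`). [OURS · PROVED] -/
theorem ndInvCLN_end (F : AlgebraicGeometry.Scheme.{0}) (ρ : F ⟶ (Literature.AlgebraicGeometry.Motives.projectiveSpace n k).left) (T : Set F) (h : NDInvCLN n k 0 F ρ T) :
    Literature.AlgebraicGeometry.Resolution.Scheme.IsRegular (AlgebraicGeometry.Scheme.IdealSheafData.vanishingIdeal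
      (⟨closure T, isClosed_closure⟩ : TopologicalSpace.Closeds F)).subscheme :=
  ndInvC_end n k F ρ T h.1

/-- **`RoundAtNDFrameLN n k`** = the tree's `RoundAtNDFrame` with `IsLocallyNoetherian F₁ →` after `IsRegular F₁ →` and `IsLocallyNoetherian F₉ ∧` after `IsRegular F₉ ∧`
(token-identical otherwise). [OURS · L1 W4.5b · statement (Prop)] -/
def RoundAtNDFrameLN : Prop :=
  ∀ (F₁ : AlgebraicGeometry.Scheme.{0}) (ρ : F₁ ⟶ (Literature.AlgebraicGeometry.Motives.projectiveSpace n k).left) (T₁ : Set F₁),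
    Literature.AlgebraicGeometry.Resolution.Scheme.IsRegular F₁ → IsLocallyNoetherian F₁ → IsClosed T₁ →
    ∀ (x : F₁) (hx : IsClosed ({x} : Set F₁)) (W : Fin n → F₁.IdealSheafData), IsNDFrameAt n k ρ T₁ W x →
    ∀ (F₂ : AlgebraicGeometry.Scheme.{0}) (υ : F₂ ⟶ F₁),
      Literature.AlgebraicGeometry.Resolution.IsBlowup υ
        (AlgebraicGeometry.Scheme.IdealSheafData.vanishingIdeal (⟨{x}, hx⟩ : TopologicalSpace.Closeds F₁)) →
      ∃ (F₉ : AlgebraicGeometry.Scheme.{0}) (β : F₉ ⟶ F₂) (T₉ : Set F₉),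
        StrataTower F₂ ((frameBoundary W).stepAlong
            (AlgebraicGeometry.Scheme.IdealSheafData.vanishingIdeal (⟨{x}, hx⟩ : TopologicalSpace.Closeds F₁)) 1 υ)
          (closure (υ ⁻¹' (T₁ \ {x}))) F₉ β T₉ ∧
        Literature.AlgebraicGeometry.Resolution.Scheme.IsRegular F₉ ∧ IsLocallyNoetherian F₉ ∧ IsClosed T₉ ∧
        (∀ z : ↥(AlgebraicGeometry.Scheme.IdealSheafData.vanishingIdeal (⟨closure T₉, isClosed_closure⟩ : TopologicalSpace.Closeds F₉)).subscheme, ((AlgebraicGeometry.Scheme.IdealSheafData.vanishingIdeal (⟨closure T₉, isClosed_closure⟩ : TopologicalSpace.Closeds F₉)).subschemeι z : F₉) ∈ (β ≫ υ) ⁻¹' {x} →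
          IsRegularLocalRing ((AlgebraicGeometry.Scheme.IdealSheafData.vanishingIdeal (⟨closure T₉, isClosed_closure⟩ : TopologicalSpace.Closeds F₉)).subscheme.presheaf.stalk z)) ∧
        CategoryTheory.IsIso ((β ≫ υ) ∣_ (⟨{x}ᶜ, hx.isOpen_compl⟩ : F₁.Opens)) ∧
        T₉ ∩ (β ≫ υ) ⁻¹' {x}ᶜ = (β ≫ υ) ⁻¹' (T₁ \ {x})

/-- **`TransportRoundLN n k`** = the tree's `TransportRound` with the same two `IsLocallyNoetherian` insertions (token-identical otherwise; the `ModelRound n k g`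
hypothesis is kept for shape and is not used by `transportRoundLN_of_toricStage`). [OURS · L1 W4.5b · statement (Prop)] -/
def TransportRoundLN : Prop :=
  ∀ (F₁ : AlgebraicGeometry.Scheme.{0}) (ρ : F₁ ⟶ (Literature.AlgebraicGeometry.Motives.projectiveSpace n k).left) (T₁ : Set F₁),
    Literature.AlgebraicGeometry.Resolution.Scheme.IsRegular F₁ → IsLocallyNoetherian F₁ → IsClosed T₁ →
    ∀ (x : F₁) (hx : IsClosed ({x} : Set F₁)) (W : Fin n → F₁.IdealSheafData)
      (w : Fin n → F₁.presheaf.stalk x) (g : MvPolynomial (Fin n) k),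
      (∀ j, stalkIdeal (W j) x = Ideal.span {w j}) →
      Ideal.span (Set.range w) = IsLocalRing.maximalIdeal (F₁.presheaf.stalk x) →
      ringKrullDim (F₁.presheaf.stalk x) = (n : WithBot ℕ∞) →
      LocalNDWon g →
      stalkIdeal (AlgebraicGeometry.Scheme.IdealSheafData.vanishingIdeal (⟨closure T₁, isClosed_closure⟩ : TopologicalSpace.Closeds F₁)) x =
        Ideal.span {MvPolynomial.eval₂ (baseToStalk n k ρ x) w g} →
      ModelRound n k g →
    ∀ (F₂ : AlgebraicGeometry.Scheme.{0}) (υ : F₂ ⟶ F₁),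
      Literature.AlgebraicGeometry.Resolution.IsBlowup υ
        (AlgebraicGeometry.Scheme.IdealSheafData.vanishingIdeal (⟨{x}, hx⟩ : TopologicalSpace.Closeds F₁)) →
      ∃ (F₉ : AlgebraicGeometry.Scheme.{0}) (β : F₉ ⟶ F₂) (T₉ : Set F₉),
        StrataTower F₂ ((frameBoundary W).stepAlong
            (AlgebraicGeometry.Scheme.IdealSheafData.vanishingIdeal (⟨{x}, hx⟩ : TopologicalSpace.Closeds F₁)) 1 υ)
          (closure (υ ⁻¹' (T₁ \ {x}))) F₉ β T₉ ∧
        Literature.AlgebraicGeometry.Resolution.Scheme.IsRegular F₉ ∧ IsLocallyNoetherian F₉ ∧ IsClosed T₉ ∧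
        (∀ z : ↥(AlgebraicGeometry.Scheme.IdealSheafData.vanishingIdeal (⟨closure T₉, isClosed_closure⟩ : TopologicalSpace.Closeds F₉)).subscheme, ((AlgebraicGeometry.Scheme.IdealSheafData.vanishingIdeal (⟨closure T₉, isClosed_closure⟩ : TopologicalSpace.Closeds F₉)).subschemeι z : F₉) ∈ (β ≫ υ) ⁻¹' {x} →
          IsRegularLocalRing ((AlgebraicGeometry.Scheme.IdealSheafData.vanishingIdeal (⟨closure T₉, isClosed_closure⟩ : TopologicalSpace.Closeds F₉)).subscheme.presheaf.stalk z)) ∧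
        CategoryTheory.IsIso ((β ≫ υ) ∣_ (⟨{x}ᶜ, hx.isOpen_compl⟩ : F₁.Opens)) ∧
        T₉ ∩ (β ≫ υ) ⁻¹' {x}ᶜ = (β ≫ υ) ⁻¹' (T₁ \ {x})

/-- (B4α′-LN) from the model round and the LN transport (copy of the tree's `roundAtNDFrame_of_model`). [OURS · pure logic] -/
theorem roundAtNDFrameLN_of_model (hα : ∀ g : MvPolynomial (Fin n) k, LocalNDWon g → ModelRound n k g) (hβ : TransportRoundLN n k) :
    RoundAtNDFrameLN n k := by
  intro F₁ ρ T₁ hreg hLN hT₁ x hx W hW F₂ υ hυ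
  obtain ⟨w, g, h1, h2, h3, h4, h5⟩ := hW
  exact hβ F₁ ρ T₁ hreg hLN hT₁ x hx W w g h1 h2 h3 h4 h5 (hα g h4) F₂ υ hυ

/-- (B4-round-LN) `RoundFacts` for `NDInvCLN` from `RoundAtNDFrameLN` and the tree's PROVED persistence `NDInvPersists` (copy of the tree's `ndInv_round_of`
with the LN conjunct threaded). [OURS · pure logic] -/
theorem ndInvLN_round_of (hα : RoundAtNDFrameLN n k) (hβ : NDInvPersists n k) : RoundFacts n k (NDInvCLN n k) := by
  intro m F₁ ρ T₁ h
  obtain ⟨⟨⟨hreg, S, hcard, hiff, hS⟩, hT₁⟩, hLN⟩ := h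
  obtain ⟨x, hxS⟩ := Finset.card_pos.mp (by omega : 0 < S.card)
  obtain ⟨⟨z, hz⟩, hxcl, W, hW⟩ := hS x hxS
  subst hz
  have hnreg : ¬ IsRegularLocalRing ((AlgebraicGeometry.Scheme.IdealSheafData.vanishingIdeal
      (⟨closure T₁, isClosed_closure⟩ : TopologicalSpace.Closeds F₁)).subscheme.presheaf.stalk z) := fun hr => (hiff z).mp hr hxS
  refine ⟨z, hxcl, hnreg, hreg _, fun F₂ υ hυ => ?_⟩
  obtain ⟨F₉, β, T₉, htower, hreg₉, hLN₉, hT₉, hend, hiso, hbook⟩ := hα F₁ ρ T₁ hreg hLN hT₁ _ hxcl W hW F₂ υ hυ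
  refine ⟨F₉, β, T₉, ⟨hxcl, W, isFrameAt_of_isNDFrameAt n k hW, htower⟩, m, le_refl m, ⟨?_, hT₉⟩, hLN₉⟩
  exact hβ m F₁ ρ T₁ ⟨hreg, S, hcard, hiff, hS⟩ _ hxcl ⟨z, rfl, hnreg⟩ F₂ υ hυ F₉ β T₉ hreg₉ hT₉ hend hiso hbook

/-! ## 13.15 (B4β) SUB-SPLIT — the LINKED replay of the good play (v11: every F-stage locally Noetherian) -/

/-- The FRAME BASE MAP `Spec 𝒪_{F₁,x} ⟶ 𝔸ⁿ_k`, `t_j ↦ w_j` over the structure map `baseToStalk`. [OURS · model object] -/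
def frameBaseMap {F₁ : AlgebraicGeometry.Scheme.{0}} (ρ : F₁ ⟶ (Literature.AlgebraicGeometry.Motives.projectiveSpace n k).left) (x : F₁)
    (w : Fin n → F₁.presheaf.stalk x) : AlgebraicGeometry.Spec (F₁.presheaf.stalk x) ⟶ Aff n k :=
  AlgebraicGeometry.Spec.map (CommRingCat.ofHom (MvPolynomial.eval₂Hom (baseToStalk n k ρ x) w))

/-- **`Linked`** — over the local base `Spec 𝒪_{F₁,x}` (to `F₁` by `fromSpecStalk`, to `𝔸ⁿ_k` by `h`), ONE scheme `L` is the pullback of the F-stage AND of the model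
stage, with equal pulled-back boundaries and `T`'s.  [OURS · L1 W4.5b · definition] -/
def Linked (F₁ : AlgebraicGeometry.Scheme.{0}) (x : F₁) (h : AlgebraicGeometry.Spec (F₁.presheaf.stalk x) ⟶ Aff n k)
    (F : AlgebraicGeometry.Scheme.{0}) (φF : F ⟶ F₁) (EF : Boundary n F) (TF : Set F)
    (A : AlgebraicGeometry.Scheme.{0}) (φA : A ⟶ Aff n k) (EA : Boundary n A) (TA : Set A) : Prop :=
  ∃ (L : AlgebraicGeometry.Scheme.{0}) (a : L ⟶ F) (b : L ⟶ A) (c : L ⟶ AlgebraicGeometry.Spec (F₁.presheaf.stalk x)),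
    IsPullback a c φF (F₁.fromSpecStalk x) ∧ IsPullback b c φA h ∧
    (∀ ρ, (EF ρ).comap a = (EA ρ).comap b) ∧ a ⁻¹' TF = b ⁻¹' TA

/-- **`FStage`** — the light F-SIDE stage invariant relative to `(F₁, x, T₁)`: `F` locally Noetherian (v11), iso off `x`, exact bookkeeping off `x`, `T` closed, non-frame members over `x`.
[OURS · L1 W4.5b · definition] -/
def FStage (F₁ : AlgebraicGeometry.Scheme.{0}) (x : F₁) (hx : IsClosed ({x} : Set F₁)) (T₁ : Set F₁)
    (F : AlgebraicGeometry.Scheme.{0}) (φF : F ⟶ F₁) (EF : Boundary n F) (TF : Set F) : Prop :=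
  IsLocallyNoetherian F ∧ CategoryTheory.IsIso (φF ∣_ (⟨{x}ᶜ, hx.isOpen_compl⟩ : F₁.Opens)) ∧ TF ∩ φF ⁻¹' {x}ᶜ = φF ⁻¹' (T₁ \ {x}) ∧ IsClosed TF ∧
  (∀ ρ, ρ ∉ Set.range (e n) → ((EF ρ).support : Set F) ⊆ φF ⁻¹' {x})

/-- **(B4β0) `TransportInit n k`** — in the data of `TransportRound`: the point blow-up `υ` of `x` and ANY blow-up `π₀` of the origin give the first F-stage and the
first LINK (stepped frame boundaries, closures).  [OURS · L1 W4.5b · statement (Prop)] -/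
def TransportInit : Prop :=
  ∀ (F₁ : AlgebraicGeometry.Scheme.{0}) (ρ : F₁ ⟶ (Literature.AlgebraicGeometry.Motives.projectiveSpace n k).left) (T₁ : Set F₁),
    Literature.AlgebraicGeometry.Resolution.Scheme.IsRegular F₁ → IsLocallyNoetherian F₁ → IsClosed T₁ →
    ∀ (x : F₁) (hx : IsClosed ({x} : Set F₁)) (W : Fin n → F₁.IdealSheafData)
      (w : Fin n → F₁.presheaf.stalk x) (g : MvPolynomial (Fin n) k),
      (∀ j, stalkIdeal (W j) x = Ideal.span {w j}) →
      Ideal.span (Set.range w) = IsLocalRing.maximalIdeal (F₁.presheaf.stalk x) →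
      ringKrullDim (F₁.presheaf.stalk x) = (n : WithBot ℕ∞) →
      LocalNDWon g →
      stalkIdeal (AlgebraicGeometry.Scheme.IdealSheafData.vanishingIdeal (⟨closure T₁, isClosed_closure⟩ : TopologicalSpace.Closeds F₁)) x =
        Ideal.span {MvPolynomial.eval₂ (baseToStalk n k ρ x) w g} →
    ∀ (F₂ : AlgebraicGeometry.Scheme.{0}) (υ : F₂ ⟶ F₁),
      Literature.AlgebraicGeometry.Resolution.IsBlowup υ
        (AlgebraicGeometry.Scheme.IdealSheafData.vanishingIdeal (⟨{x}, hx⟩ : TopologicalSpace.Closeds F₁)) →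
    ∀ (A₂ : AlgebraicGeometry.Scheme.{0}) (π₀ : A₂ ⟶ Aff n k),
      Literature.AlgebraicGeometry.Resolution.IsBlowup π₀
        (AlgebraicGeometry.Scheme.IdealSheafData.vanishingIdeal (⟨{affOrigin n k}, isClosed_affOrigin n k⟩ : TopologicalSpace.Closeds (Aff n k))) →
      FStage n F₁ x hx T₁ F₂ υ
        ((frameBoundary W).stepAlong (AlgebraicGeometry.Scheme.IdealSheafData.vanishingIdeal (⟨{x}, hx⟩ : TopologicalSpace.Closeds F₁)) 1 υ)
        (closure (υ ⁻¹' (T₁ \ {x}))) ∧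
      Linked n k F₁ x (frameBaseMap n k ρ x w) F₂ υ
        ((frameBoundary W).stepAlong (AlgebraicGeometry.Scheme.IdealSheafData.vanishingIdeal (⟨{x}, hx⟩ : TopologicalSpace.Closeds F₁)) 1 υ)
        (closure (υ ⁻¹' (T₁ \ {x})))
        A₂ π₀
        ((frameBoundary (coordHyperplane n k)).stepAlong
          (AlgebraicGeometry.Scheme.IdealSheafData.vanishingIdeal (⟨{affOrigin n k}, isClosed_affOrigin n k⟩ : TopologicalSpace.Closeds (Aff n k))) 1 π₀)
        (closure (π₀ ⁻¹' (PrimeSpectrum.zeroLocus {g} \ {affOrigin n k})))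

/-- **(B4β1) `TransportStep n k`** — ONE LINKED STEP: at an F-stage linked to a model toric stage, a model move (Bad face `τ ⊆ σ ∈ Φ` with a non-frame ray, fresh,
model-legal, and the model's new toric stage after a blow-up `υA` of its stratum) is F-LEGAL, and ANY blow-up `υF` of the F-side stratum gives the next F-stage, linked
to the model's next stage.  [OURS · L1 W4.5b · statement (Prop)] -/
def TransportStep : Prop :=
  ∀ (F₁ : AlgebraicGeometry.Scheme.{0}) (ρ : F₁ ⟶ (Literature.AlgebraicGeometry.Motives.projectiveSpace n k).left) (T₁ : Set F₁),
    Literature.AlgebraicGeometry.Resolution.Scheme.IsRegular F₁ → IsLocallyNoetherian F₁ → IsClosed T₁ →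
    ∀ (x : F₁) (hx : IsClosed ({x} : Set F₁)) (W : Fin n → F₁.IdealSheafData)
      (w : Fin n → F₁.presheaf.stalk x) (g : MvPolynomial (Fin n) k),
      (∀ j, stalkIdeal (W j) x = Ideal.span {w j}) →
      Ideal.span (Set.range w) = IsLocalRing.maximalIdeal (F₁.presheaf.stalk x) →
      ringKrullDim (F₁.presheaf.stalk x) = (n : WithBot ℕ∞) →
      LocalNDWon g →
      stalkIdeal (AlgebraicGeometry.Scheme.IdealSheafData.vanishingIdeal (⟨closure T₁, isClosed_closure⟩ : TopologicalSpace.Closeds F₁)) x =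
        Ideal.span {MvPolynomial.eval₂ (baseToStalk n k ρ x) w g} →
    ∀ (Φ : Finset (Finset (Ray n)))
      (F : AlgebraicGeometry.Scheme.{0}) (φF : F ⟶ F₁) (EF : Boundary n F) (TF : Set F)
      (A : AlgebraicGeometry.Scheme.{0}) (φA : A ⟶ Aff n k) (EA : Boundary n A) (TA : Set A),
      FStage n F₁ x hx T₁ F φF EF TF → Linked n k F₁ x (frameBaseMap n k ρ x w) F φF EF TF A φA EA TA → ToricStage n k g Φ A φA EA TA →
    ∀ σ ∈ Φ, ∀ τ : Finset (Ray n), τ ⊆ σ → Bad (table g) τ → (∃ ρ ∈ τ, ρ ∉ Set.range (e n)) →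
      (∀ σ' ∈ Φ, ¬ τ ⊆ σ' → (∑ ρ ∈ τ, ρ) ∉ σ') →
      ((stratum EA τ).support : Set A) ⊆ TA → ¬ TA ⊆ ((stratum EA τ).support : Set A) →
    ∀ (A' : AlgebraicGeometry.Scheme.{0}) (υA : A' ⟶ A), Literature.AlgebraicGeometry.Resolution.IsBlowup υA (stratum EA τ) →
      ToricStage n k g (star Φ τ) A' (υA ≫ φA) (EA.stepAlong (stratum EA τ) (∑ ρ ∈ τ, ρ) υA)
        (closure (υA ⁻¹' (TA \ ((stratum EA τ).support : Set A)))) →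
      (((stratum EF τ).support : Set F) ⊆ TF ∧ ¬ TF ⊆ ((stratum EF τ).support : Set F)) ∧
      ∀ (F' : AlgebraicGeometry.Scheme.{0}) (υF : F' ⟶ F), Literature.AlgebraicGeometry.Resolution.IsBlowup υF (stratum EF τ) →
        FStage n F₁ x hx T₁ F' (υF ≫ φF) (EF.stepAlong (stratum EF τ) (∑ ρ ∈ τ, ρ) υF)
          (closure (υF ⁻¹' (TF \ ((stratum EF τ).support : Set F)))) ∧
        Linked n k F₁ x (frameBaseMap n k ρ x w) F' (υF ≫ φF) (EF.stepAlong (stratum EF τ) (∑ ρ ∈ τ, ρ) υF)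
          (closure (υF ⁻¹' (TF \ ((stratum EF τ).support : Set F))))
          A' (υA ≫ φA) (EA.stepAlong (stratum EA τ) (∑ ρ ∈ τ, ρ) υA)
          (closure (υA ⁻¹' (TA \ ((stratum EA τ).support : Set A))))

/-- **(B4β2) `TransportEnd n k`** — ASCENT AT THE END: an F-stage linked to a REGULAR model TORIC stage (some fan `Φ`: excludes junk `A`, and makes `A`
locally of finite type over `k`, which the fibre-regularity of `κ(x) ⊗_k κ(a)` needs) with END over the origin is regular with END over `x`.
[OURS · L1 W4.5b · statement (Prop)] -/
def TransportEnd : Prop :=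
  ∀ (F₁ : AlgebraicGeometry.Scheme.{0}) (ρ : F₁ ⟶ (Literature.AlgebraicGeometry.Motives.projectiveSpace n k).left) (T₁ : Set F₁),
    Literature.AlgebraicGeometry.Resolution.Scheme.IsRegular F₁ → IsLocallyNoetherian F₁ → IsClosed T₁ →
    ∀ (x : F₁) (hx : IsClosed ({x} : Set F₁)) (W : Fin n → F₁.IdealSheafData)
      (w : Fin n → F₁.presheaf.stalk x) (g : MvPolynomial (Fin n) k),
      (∀ j, stalkIdeal (W j) x = Ideal.span {w j}) →
      Ideal.span (Set.range w) = IsLocalRing.maximalIdeal (F₁.presheaf.stalk x) →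
      ringKrullDim (F₁.presheaf.stalk x) = (n : WithBot ℕ∞) →
      LocalNDWon g →
      stalkIdeal (AlgebraicGeometry.Scheme.IdealSheafData.vanishingIdeal (⟨closure T₁, isClosed_closure⟩ : TopologicalSpace.Closeds F₁)) x =
        Ideal.span {MvPolynomial.eval₂ (baseToStalk n k ρ x) w g} →
    ∀ (F : AlgebraicGeometry.Scheme.{0}) (φF : F ⟶ F₁) (EF : Boundary n F) (TF : Set F)
      (A : AlgebraicGeometry.Scheme.{0}) (φA : A ⟶ Aff n k) (EA : Boundary n A) (TA : Set A),
      FStage n F₁ x hx T₁ F φF EF TF → Linked n k F₁ x (frameBaseMap n k ρ x w) F φF EF TF A φA EA TA →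
      (∃ Φ : Finset (Finset (Ray n)), ToricStage n k g Φ A φA EA TA) →
      Literature.AlgebraicGeometry.Resolution.Scheme.IsRegular A →
      (∀ z : ↥(AlgebraicGeometry.Scheme.IdealSheafData.vanishingIdeal (⟨closure TA, isClosed_closure⟩ : TopologicalSpace.Closeds A)).subscheme, ((AlgebraicGeometry.Scheme.IdealSheafData.vanishingIdeal (⟨closure TA, isClosed_closure⟩ : TopologicalSpace.Closeds A)).subschemeι z : A) ∈ φA ⁻¹' {affOrigin n k} →
        IsRegularLocalRing ((AlgebraicGeometry.Scheme.IdealSheafData.vanishingIdeal (⟨closure TA, isClosed_closure⟩ : TopologicalSpace.Closeds A)).subscheme.presheaf.stalk z)) →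
      Literature.AlgebraicGeometry.Resolution.Scheme.IsRegular F ∧
      (∀ z : ↥(AlgebraicGeometry.Scheme.IdealSheafData.vanishingIdeal (⟨closure TF, isClosed_closure⟩ : TopologicalSpace.Closeds F)).subscheme, ((AlgebraicGeometry.Scheme.IdealSheafData.vanishingIdeal (⟨closure TF, isClosed_closure⟩ : TopologicalSpace.Closeds F)).subschemeι z : F) ∈ φF ⁻¹' {x} →
        IsRegularLocalRing ((AlgebraicGeometry.Scheme.IdealSheafData.vanishingIdeal (⟨closure TF, isClosed_closure⟩ : TopologicalSpace.Closeds F)).subscheme.presheaf.stalk z))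

/-- THE JOINT ITERATION (proved): along a good play, an F-stage linked to a model toric stage grows an F-side `StrataTower` ending in an F-stage linked to a model toric
stage at the final fan — both blow-ups REALISED by `exists_isBlowup`, model legality / new model stage by (B4α1s), F-legality / new F-stage / new link by (B4β1).
[OURS · pure logic + Literature `exists_isBlowup`] -/
theorem linkedTower_of_goodPlay
    (F₁ : AlgebraicGeometry.Scheme.{0}) (ρ : F₁ ⟶ (Literature.AlgebraicGeometry.Motives.projectiveSpace n k).left) (T₁ : Set F₁)
    (hreg : Literature.AlgebraicGeometry.Resolution.Scheme.IsRegular F₁) (hLN : IsLocallyNoetherian F₁) (hT₁ : IsClosed T₁)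
    (x : F₁) (hx : IsClosed ({x} : Set F₁)) (W : Fin n → F₁.IdealSheafData)
    (w : Fin n → F₁.presheaf.stalk x) (g : MvPolynomial (Fin n) k)
    (h1 : ∀ j, stalkIdeal (W j) x = Ideal.span {w j})
    (h2 : Ideal.span (Set.range w) = IsLocalRing.maximalIdeal (F₁.presheaf.stalk x))
    (h3 : ringKrullDim (F₁.presheaf.stalk x) = (n : WithBot ℕ∞))
    (h4 : LocalNDWon g)
    (h5 : stalkIdeal (AlgebraicGeometry.Scheme.IdealSheafData.vanishingIdeal (⟨closure T₁, isClosed_closure⟩ : TopologicalSpace.Closeds F₁)) x =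
      Ideal.span {MvPolynomial.eval₂ (baseToStalk n k ρ x) w g})
    (hS : ModelStep n k g) (tS : TransportStep n k) {Φ Φ'' : Finset (Finset (Ray n))} (hP : GoodPlay n (table g) Φ Φ'') :
    ∀ (F : AlgebraicGeometry.Scheme.{0}) (φF : F ⟶ F₁) (EF : Boundary n F) (TF : Set F)
      (A : AlgebraicGeometry.Scheme.{0}) (φA : A ⟶ Aff n k) (EA : Boundary n A) (TA : Set A),
      FStage n F₁ x hx T₁ F φF EF TF → Linked n k F₁ x (frameBaseMap n k ρ x w) F φF EF TF A φA EA TA → ToricStage n k g Φ A φA EA TA →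
      ∃ (F₉ : AlgebraicGeometry.Scheme.{0}) (βF : F₉ ⟶ F) (T₉F : Set F₉) (E₉F : Boundary n F₉)
        (A₉ : AlgebraicGeometry.Scheme.{0}) (βA : A₉ ⟶ A) (T₉A : Set A₉) (E₉A : Boundary n A₉),
        StrataTower F EF TF F₉ βF T₉F ∧ FStage n F₁ x hx T₁ F₉ (βF ≫ φF) E₉F T₉F ∧
        Linked n k F₁ x (frameBaseMap n k ρ x w) F₉ (βF ≫ φF) E₉F T₉F A₉ (βA ≫ φA) E₉A T₉A ∧ ToricStage n k g Φ'' A₉ (βA ≫ φA) E₉A T₉A := by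
  induction hP with
  | done Φ =>
    intro F φF EF TF A φA EA TA hF hL hA
    refine ⟨F, 𝟙 F, TF, EF, A, 𝟙 A, TA, EA, StrataTower.nil F EF TF, ?_, ?_, ?_⟩
    · rw [CategoryTheory.Category.id_comp]; exact hF
    · rw [CategoryTheory.Category.id_comp, CategoryTheory.Category.id_comp]; exact hL
    · rw [CategoryTheory.Category.id_comp]; exact hA
  | move Φ Φ' σ τ hσ hτσ hbad hnf hfresh hrest ih =>
    intro F φF EF TF A φA EA TA hF hL hA
    obtain ⟨⟨hE1A, hTA⟩, hstepA⟩ := hS Φ A φA EA TA hA σ hσ τ hτσ hbad hnf hfresh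
    obtain ⟨A', υA, hυA⟩ := Literature.AlgebraicGeometry.Resolution.exists_isBlowup A (stratum EA τ)
    have hA' := hstepA A' υA hυA
    obtain ⟨⟨hE1F, hTF⟩, hstepF⟩ :=
      tS F₁ ρ T₁ hreg hLN hT₁ x hx W w g h1 h2 h3 h4 h5 Φ F φF EF TF A φA EA TA hF hL hA σ hσ τ hτσ hbad hnf hfresh hE1A hTA A' υA hυA hA'
    obtain ⟨F', υF, hυF⟩ := Literature.AlgebraicGeometry.Resolution.exists_isBlowup F (stratum EF τ)
    obtain ⟨hF', hL'⟩ := hstepF F' υF hυF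
    obtain ⟨F₉, βF, T₉F, E₉F, A₉, βA, T₉A, E₉A, htower, hF₉, hL₉, hA₉⟩ := ih F' (υF ≫ φF) _ _ A' (υA ≫ φA) _ _ hF' hL' hA'
    refine ⟨F₉, βF ≫ υF, T₉F, E₉F, A₉, βA ≫ υA, T₉A, E₉A, StrataTower.cons F EF TF τ hnf hE1F hTF F' υF hυF F₉ βF T₉F htower, ?_, ?_, ?_⟩
    · rw [CategoryTheory.Category.assoc]; exact hF₉
    · rw [CategoryTheory.Category.assoc, CategoryTheory.Category.assoc]; exact hL₉
    · rw [CategoryTheory.Category.assoc]; exact hA₉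

/-- **THE (B4β) COMPOSITION, PROVED**: the finer model bricks + (B4β0) init-link + (B4β1) linked step + (B4β2) end-ascent ⟹ `TransportRoundLN` (v11: the LN transport round of §13.13′).  (The hypothesis
`ModelRound n k g` inside `TransportRound` is not used: the model is rebuilt stage by stage from (B4α1i)/(B4α1s)/(B4α2) so that its invariants are visible.)
[OURS · pure logic] -/
theorem transportRoundLN_of_toricStage (h0 : PlayFacts n) (hI : ∀ g : MvPolynomial (Fin n) k, LocalND g → ModelInit n k g)
    (hS : ∀ g : MvPolynomial (Fin n) k, LocalND g → ModelStep n k g) (hE : ∀ g : MvPolynomial (Fin n) k, LocalND g → ModelEnd n k g)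
    (tI : TransportInit n k) (tS : TransportStep n k) (tE : TransportEnd n k) : TransportRoundLN n k := by
  intro F₁ ρ T₁ hreg hLN hT₁ x hx W w g h1 h2 h3 h4 h5 _hMR F₂ υ hυ
  obtain ⟨hL, Φ', hR, hW⟩ := h4
  have hV : (table g).Nonempty := table_nonempty (ne_zero_of_isLocallyND hL.2)
  obtain ⟨Φ'', hP, hW''⟩ := h0 (table g) (isConvenientTable_table hL.1) hV Φ' hR hW
  obtain ⟨A₂, π₀, hπ₀⟩ := Literature.AlgebraicGeometry.Resolution.exists_isBlowup (Aff n k)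
    (AlgebraicGeometry.Scheme.IdealSheafData.vanishingIdeal (⟨{affOrigin n k}, isClosed_affOrigin n k⟩ : TopologicalSpace.Closeds (Aff n k)))
  have hA₂ := hI g hL A₂ π₀ hπ₀
  obtain ⟨hF₂, hL₂⟩ := tI F₁ ρ T₁ hreg hLN hT₁ x hx W w g h1 h2 h3 ⟨hL, Φ', hR, hW⟩ h5 F₂ υ hυ A₂ π₀ hπ₀
  obtain ⟨F₉, βF, T₉F, E₉F, A₉, βA, T₉A, E₉A, htower, hF₉, hL₉, hA₉⟩ :=
    linkedTower_of_goodPlay n k F₁ ρ T₁ hreg hLN hT₁ x hx W w g h1 h2 h3 ⟨hL, Φ', hR, hW⟩ h5 (hS g hL) tS hP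
      F₂ υ _ _ A₂ π₀ _ _ hF₂ hL₂ hA₂
  obtain ⟨hregA, hendA⟩ := hE g hL Φ'' A₉ (βA ≫ π₀) E₉A T₉A hA₉ hW''
  obtain ⟨hregF, hendF⟩ := tE F₁ ρ T₁ hreg hLN hT₁ x hx W w g h1 h2 h3 ⟨hL, Φ', hR, hW⟩ h5 F₉ (βF ≫ υ) E₉F T₉F A₉ (βA ≫ π₀) E₉A T₉A hF₉ hL₉ ⟨Φ'', hA₉⟩ hregA hendA
  obtain ⟨hLN₉, hiso, hbook, hclosed, -⟩ := hF₉
  exact ⟨F₉, βF, T₉F, htower, hregF, hLN₉, hclosed, hendF, hiso, hbook⟩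

end RoundModel

end Summit.ResolutionOfSingularities.ResolutionOfSingularities.Cruxes.EquisingularLiftNat.Sections.ND

end
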